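import Summits.KontsevichZagierPeriods.KontsevichZagierPeriods.Theorems.LinRedNormalFormArrangementNormalFormStubRebaseSimpleZeroNestedDiffFrameA

/-!
# Stub `stub_rebaseSimpleZeroTwo`, part `HPar1` (crux `ArrangementNormalForm`, line `janus-bands`)
— brick `NestedDiffE2BlowMap`

The **base blow-up chart** of the E2 route (different-slope clean nest, one bound
letter-parallel, the wall of the edge expansion ENTERING the band). In the normalised frame of
`RebaseDiff.good_coreA` (outer letter `κ` and top `β` constant, inner letter `cᵢ` of slope
`λ ≠ 0`, base pole `r`, wall `ρ = cᵢ(r)`) the two singular forms `tᵢ − cᵢ(y)` and `y − r` of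
the literal integrand `K/((y − r)(tᵢ − cᵢ(y))(tⱼ − κ))` both vanish on the line
`{y = r, tᵢ = ρ}`; blowing this line up, i.e. taking the RATIO `b = (tᵢ − ρ)/(y − r)` as the
new base coordinate, makes ALL letters constant:
`K dy dtᵢ dtⱼ/((y − r)(tᵢ − cᵢ(y))(tⱼ − κ)) = ± K db dtᵢ dtⱼ/((b − λ)(tᵢ − ρ)(tⱼ − κ))`,
and every domain constraint that is a row of the base, a comparison not involving `y`, or a bound
through the centre `(r, ρ)` becomes a comparison between players of the new coordinates. This
file: the chart `RebaseDiff.blowΨ : (b, tᵢ, tⱼ) ↦ (r + (tᵢ − ρ)/b, tᵢ, tⱼ)`, its inverse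
`RebaseDiff.blowΦ`, its derivative `RebaseDiff.blowΨL` (a rank-one perturbation of the identity,
Jacobian `−(tᵢ − ρ)/b²`), injectivity and semialgebraicity. Registered:
`rebaseSimpleZero_e2BlowDet`.

References: M. Kontsevich, D. Zagier, *Periods* (2001), §1.2, rule (2).
-/

noncomputable section

open Set MeasureTheory MvPolynomial
open Literature.NumberTheory.Transcendental Literature.ModelTheory.ExponentialFields

namespace Summit.KontsevichZagierPeriods.ArrangementNormalForm.JanusBands

namespace RebaseDiff

open SeparatePos RebasePos RebaseZero RebaseNest

variable {i : Fin 2}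

/-! ### The chart and its inverse -/

/-- The base blow-up chart `Ψ : (b, tᵢ, tⱼ) ↦ (r + (tᵢ − ρ)/b, tᵢ, tⱼ)` (the new base `b` sits in
the slot of `y`). -/
def blowΨ (i : Fin 2) (ρ r : ℚ) (w : Fin (0 + 1 + 2) → ℝ) : Fin (0 + 1 + 2) → ℝ :=
  Function.update w (yIdx 2) ((r : ℝ) + (tv w i - ρ) / yv w)

/-- The inverse chart `Φ : (y, tᵢ, tⱼ) ↦ ((tᵢ − ρ)/(y − r), tᵢ, tⱼ)`. -/
def blowΦ (i : Fin 2) (ρ r : ℚ) (z : Fin (0 + 1 + 2) → ℝ) : Fin (0 + 1 + 2) → ℝ :=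
  Function.update z (yIdx 2) ((tv z i - ρ) / (yv z - r))

/-- The base coordinate of `blowΨ`. -/
@[simp] theorem yv_blowΨ (ρ r : ℚ) (w : Fin (0 + 1 + 2) → ℝ) :
    yv (blowΨ i ρ r w) = r + (tv w i - ρ) / yv w := by
  simp [blowΨ, yv]

/-- `blowΨ` fixes the fibres. -/
@[simp] theorem tv_blowΨ (ρ r : ℚ) (w : Fin (0 + 1 + 2) → ℝ) (l : Fin 2) :
    tv (blowΨ i ρ r w) l = tv w l := by
  simp [blowΨ, tv, Function.update_of_ne (yIdx_ne_tIdx l).symm]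

/-- The base coordinate of `blowΦ`. -/
@[simp] theorem yv_blowΦ (ρ r : ℚ) (z : Fin (0 + 1 + 2) → ℝ) :
    yv (blowΦ i ρ r z) = (tv z i - ρ) / (yv z - r) := by
  simp [blowΦ, yv]

/-- `blowΦ` fixes the fibres. -/
@[simp] theorem tv_blowΦ (ρ r : ℚ) (z : Fin (0 + 1 + 2) → ℝ) (l : Fin 2) :
    tv (blowΦ i ρ r z) l = tv z l := by
  simp [blowΦ, tv, Function.update_of_ne (yIdx_ne_tIdx l).symm]

/-- `Ψ ∘ Φ = id` off the two planes `y = r`, `tᵢ = ρ`. -/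
theorem blowΨ_blowΦ (ρ r : ℚ) {z : Fin (0 + 1 + 2) → ℝ} (hy : yv z ≠ r) (hR : tv z i ≠ ρ) :
    blowΨ i ρ r (blowΦ i ρ r z) = z := by
  have hy' : yv z - r ≠ 0 := sub_ne_zero.2 hy
  have hR' : tv z i - ρ ≠ 0 := sub_ne_zero.2 hR
  funext k
  rcases idx_cases k with rfl | ⟨l, rfl⟩
  · show yv (blowΨ i ρ r (blowΦ i ρ r z)) = yv z
    rw [yv_blowΨ, tv_blowΦ, yv_blowΦ]
    field_simp
    ring
  · show tv (blowΨ i ρ r (blowΦ i ρ r z)) l = tv z l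
    rw [tv_blowΨ, tv_blowΦ]

/-- `Φ ∘ Ψ = id` off the plane `tᵢ = ρ` (at `b = 0` both sides read `y = r` by the junk value of division). -/
theorem blowΦ_blowΨ (ρ r : ℚ) {w : Fin (0 + 1 + 2) → ℝ} (hR : tv w i ≠ ρ) :
    blowΦ i ρ r (blowΨ i ρ r w) = w := by
  have hR' : tv w i - ρ ≠ 0 := sub_ne_zero.2 hR
  funext k
  rcases idx_cases k with rfl | ⟨l, rfl⟩
  · show yv (blowΦ i ρ r (blowΨ i ρ r w)) = yv w
    rw [yv_blowΦ, tv_blowΨ, yv_blowΨ, add_sub_cancel_left, div_div_eq_mul_div, mul_div_cancel_left₀ _ hR']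
  · show tv (blowΦ i ρ r (blowΨ i ρ r w)) l = tv w l
    rw [tv_blowΦ, tv_blowΨ]

/-- `blowΨ` is injective on every set off the plane `tᵢ = ρ`. -/
theorem blowΨ_injOn (ρ r : ℚ) {Q : Set (Fin (0 + 1 + 2) → ℝ)}
    (hR : ∀ w ∈ Q, tv w i ≠ ρ) : InjOn (blowΨ i ρ r) Q := fun w hw w' hw' h => by
  rw [← blowΦ_blowΨ ρ r (hR w hw), h, blowΦ_blowΨ ρ r (hR w' hw')]

/-! ### The derivative -/

/-- `blowΨ` as a rank-one perturbation of the identity along the base vector. -/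
theorem blowΨ_eq (ρ r : ℚ) (w : Fin (0 + 1 + 2) → ℝ) :
    blowΨ i ρ r w = w + ((r : ℝ) + (tv w i - ρ) * (yv w)⁻¹ - yv w) •
      (Pi.single (yIdx 2) (1 : ℝ) : Fin (0 + 1 + 2) → ℝ) := by
  funext k
  by_cases hk : k = yIdx 2
  · subst hk
    simp only [blowΨ, Function.update_self, Pi.add_apply, Pi.smul_apply, Pi.single_eq_same, smul_eq_mul,
      mul_one, div_eq_mul_inv]
    simp only [yv]
    ring
  · simp only [blowΨ, Function.update_of_ne hk, Pi.add_apply, Pi.smul_apply, Pi.single_eq_of_ne hk,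
      smul_zero, add_zero]

/-- The derivative of `blowΨ` at `w` (off `b = 0`): the identity plus the rank-one map
`(b⁻¹ dtᵢ + (−(tᵢ − ρ) b⁻² − 1) db) ⊗ e_y`. -/
def blowΨL (i : Fin 2) (ρ : ℚ) (w : Fin (0 + 1 + 2) → ℝ) : (Fin (0 + 1 + 2) → ℝ) →L[ℝ] (Fin (0 + 1 + 2) → ℝ) :=
  ContinuousLinearMap.id ℝ _ + ContinuousLinearMap.smulRight
    ((yv w)⁻¹ • (ContinuousLinearMap.proj (R := ℝ) (φ := fun _ : Fin (0 + 1 + 2) => ℝ) (tIdx i)) +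
      (-((tv w i - ρ) * ((yv w) ^ 2)⁻¹) - 1) •
        (ContinuousLinearMap.proj (R := ℝ) (φ := fun _ : Fin (0 + 1 + 2) => ℝ) (yIdx 2)))
    (Pi.single (yIdx 2) (1 : ℝ) : Fin (0 + 1 + 2) → ℝ)

/-- `blowΨ` has the derivative `blowΨL` off `b = 0`. -/
theorem hasFDerivAt_blowΨ (ρ r : ℚ) (w : Fin (0 + 1 + 2) → ℝ) (hb : yv w ≠ 0) :
    HasFDerivAt (blowΨ i ρ r) (blowΨL i ρ w) w := by
  have h1 : HasFDerivAt (fun z : Fin (0 + 1 + 2) → ℝ => z (yIdx 2))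
      (ContinuousLinearMap.proj (R := ℝ) (φ := fun _ : Fin (0 + 1 + 2) => ℝ) (yIdx 2)) w :=
    hasFDerivAt_apply (yIdx 2) w
  have h2 : HasFDerivAt (fun z : Fin (0 + 1 + 2) → ℝ => z (tIdx i))
      (ContinuousLinearMap.proj (R := ℝ) (φ := fun _ : Fin (0 + 1 + 2) => ℝ) (tIdx i)) w :=
    hasFDerivAt_apply (tIdx i) w
  have hb' : w (yIdx 2) ≠ 0 := hb
  have h3 := (hasFDerivAt_inv hb').comp w h1
  have hφ := ((((h2.sub_const (ρ : ℝ)).mul h3).const_add (r : ℝ)).sub h1).smul_const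
    (Pi.single (yIdx 2) (1 : ℝ) : Fin (0 + 1 + 2) → ℝ)
  have key : HasFDerivAt (blowΨ i ρ r) _ w :=
    ((hasFDerivAt_id w).add hφ).congr_of_eventuallyEq (Filter.Eventually.of_forall fun z => by
      rw [blowΨ_eq]
      simp only [Pi.add_apply, Pi.sub_apply, Pi.mul_apply, Function.comp_apply, id]
      rfl)
  refine key.congr_fderiv ?_
  ext v k
  by_cases hk : k = yIdx 2
  · subst hk
    simp [blowΨL, tv, yv]
    ring
  · simp [blowΨL, hk]

/-- The Jacobian determinant of `blowΨ` is `−(tᵢ − ρ)/b²`. -/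
theorem det_blowΨL (ρ : ℚ) (w : Fin (0 + 1 + 2) → ℝ) :
    (blowΨL i ρ w).det = -((tv w i - ρ) * ((yv w) ^ 2)⁻¹) := by
  rw [blowΨL, det_id_add_smulRight]
  simp [Pi.single_eq_of_ne (yIdx_ne_tIdx i).symm]

/-- Off `tᵢ = ρ` the absolute Jacobian is `|tᵢ − ρ|/b²`. -/
theorem abs_det_blowΨL (ρ : ℚ) (w : Fin (0 + 1 + 2) → ℝ) :
    |(blowΨL i ρ w).det| = |tv w i - ρ| / (yv w) ^ 2 := by
  rw [det_blowΨL, abs_neg, abs_mul, abs_inv, abs_of_nonneg (sq_nonneg (yv w)), div_eq_mul_inv]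

/-! ### Semialgebraicity -/

/-- `blowΨ` is a `ℚ`-semialgebraic map on every `ℚ`-semialgebraic set off `b = 0` (its base
coordinate is the rational function `(r b + tᵢ − ρ)/b`, the others are coordinates). -/
theorem isSemialgebraicMapOn_blowΨ (ρ r : ℚ) {Q : Set (Fin (0 + 1 + 2) → ℝ)} (hQ : IsSemialgebraic ℚ Q)
    (hb : ∀ w ∈ Q, yv w ≠ 0) : IsSemialgebraicMapOn ℚ Q (blowΨ i ρ r) := by
  refine IsSemialgebraicMapOn.of_forall hQ fun k => ?_
  by_cases hk : k = yIdx 2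
  · subst hk
    refine (isSemialgebraicFunOn_aeval_div_aeval hQ
      (MvPolynomial.C r * X (yIdx 2) + (X (tIdx i) - MvPolynomial.C ρ)) (X (yIdx 2))
      (fun w hw => by simpa [yv] using hb w hw)).congr fun w hw => ?_
    have hb' : yv w ≠ 0 := hb w hw
    show _ = yv (blowΨ i ρ r w)
    rw [yv_blowΨ]
    simp only [map_add, map_mul, map_sub, MvPolynomial.aeval_C, MvPolynomial.aeval_X, eq_ratCast]
    change ((r : ℝ) * yv w + (tv w i - ρ)) / yv w = _
    field_simp
  · refine (isSemialgebraicFunOn_aeval hQ (X k)).congr fun w _ => ?_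
    simp only [MvPolynomial.aeval_X]
    exact (Function.update_of_ne hk _ w).symm

end RebaseDiff

/-- Registered support goal of this file (brick of the part `HPar1` of `stub_rebaseSimpleZeroTwo`):
the Jacobian of the base blow-up chart `(b, tᵢ, tⱼ) ↦ (r + (tᵢ − ρ)/b, tᵢ, tⱼ)` is
`−(tᵢ − ρ)/b²` (`RebaseDiff.det_blowΨL`, rank-one determinant lemma). -/
theorem rebaseSimpleZero_e2BlowDet (i : Fin 2) (ρ : ℚ) (w : Fin (0 + 1 + 2) → ℝ) : (RebaseDiff.blowΨL i ρ w).det = -((RebaseZero.tv w i - ρ) * ((RebaseZero.yv w) ^ 2)⁻¹) :=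
  RebaseDiff.det_blowΨL ρ w

end Summit.KontsevichZagierPeriods.ArrangementNormalForm.JanusBands
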